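import Summits.KontsevichZagierPeriods.Zeta5Search.Certificates.RayC1LineProfile
import Summits.KontsevichZagierPeriods.Zeta5Search.Certificates.RecordRayLineMajorant
import HarnessLib

/-!
# ζ(5) search — certificates: the lattice line `ℤ + iY` through the summand of the ray RayC1 — maximum
(cell `pub-zeta5`, P1 g11; port of certifier 2's `Certificates/RecordRayLineMax.lean`, generic lemmas imported by name)

HONEST FRAMING: systematic search; no irrationality claim unless certified.

OUR work (Summit side). For `b = natB (85n) (BC1E e n)` (`e = 0`: the ray, `e = 1`: the partner) and a height `Y` at which the
step certificate (`RayC1LineStep*`) holds: `NSqC1_symm` (well-poised reflection), **`NSqC1_int_le_Mx`** — every lattice value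
`N(k) = |R_b(k+iY)|²` is dominated by the two centre values `MxC1 = max(N(−h), N(−h−1/2))`, `h = (85n+2)/2`.
-/

noncomputable section

open Finset Complex Filter Topology

namespace Summit.KontsevichZagierPeriods.Zeta5Search.RayC1

open Summit.KontsevichZagierPeriods.Zeta5Search.DualSeries
open Summit.KontsevichZagierPeriods.Zeta5Search.DualSeriesBounds (natB natB_zero natB_succ)
open Summit.KontsevichZagierPeriods.Zeta5Search.DualPF (Rc)
open Summit.KontsevichZagierPeriods.Zeta5Search.RecordLine (qsq Dx Nm Dx_pos Nm_pos normSq_Rc_mul Nm_step Dx_step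
  qsq_neg Nm_symm Dx_symm iter_mono iter_threshold)

/-! ### The squared modulus as a function on the line, and its reflection symmetry -/

/-- `N_e(x) = |R_b(x + iY)|²` for `b = natB (85n) (BC1E e n)`. -/
def NSqC1 (e n : ℕ) (Y x : ℝ) : ℝ := ‖Rc (natB (85 * n) (BC1E e n)) ((x : ℂ) + Y * I)‖ ^ 2

/-- `N ≥ 0`. -/
theorem NSqC1_nonneg (e n : ℕ) (Y x : ℝ) : 0 ≤ NSqC1 e n Y x := by unfold NSqC1; positivity

/-- **Reflection symmetry**: `N_e(−(85n+2) − x) = N_e(x)` (`e ≤ 1`, `n ≥ 1`, `Y ≠ 0`). -/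
theorem NSqC1_symm {e n : ℕ} (he : e ≤ 1) (hn : 1 ≤ n) {Y : ℝ} (hY : 0 < Y) (x : ℝ) :
    NSqC1 e n Y (-(((85 * n : ℕ) : ℝ) + 2) - x) = NSqC1 e n Y x := by
  have hreg := hreg_c1E he hn
  have h1 := normSq_Rc_mul (85 * n) (BC1E e n) hreg (x := -(((85 * n : ℕ) : ℝ) + 2) - x) hY.ne'
  have h2 := normSq_Rc_mul (85 * n) (BC1E e n) hreg (x := x) hY.ne'
  rw [Nm_symm, Dx_symm _ _ hreg] at h1
  have hD := Dx_pos (85 * n) (BC1E e n) hY x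
  unfold NSqC1
  have e1 := (eq_div_iff hD.ne').2 h1
  have e2 := (eq_div_iff hD.ne').2 h2
  push_cast at e1 e2 ⊢
  rw [e1, e2]

/-! ### Centre values -/

/-- The centre value bound: `MxC1 = max(N(−h), N(−h − 1/2))`, `h = (85n+2)/2`. -/
def MxC1 (e n : ℕ) (Y : ℝ) : ℝ :=
  max (NSqC1 e n Y (-((((85 * n : ℕ) : ℝ) + 2) / 2))) (NSqC1 e n Y (-((((85 * n : ℕ) : ℝ) + 2) / 2) - 1 / 2))

/-- `MxC1 ≥ 0`. -/
theorem MxC1_nonneg (e n : ℕ) (Y : ℝ) : 0 ≤ MxC1 e n Y := (NSqC1_nonneg _ _ _ _).trans (le_max_left _ _)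

/-! ### The lattice bound -/

section Lattice

variable {e n : ℕ} (he : e ≤ 1) (hn : 1 ≤ n) {Y : ℝ} (hY : 0 < Y)
  (hcert : ∀ a : ℝ, 1 / 2 ≤ a → stepDenC1 e n Y a ≤ stepNumC1 e n Y a)
include he hn hY hcert

/-- The monotone step in the variable `x`: `N(x) ≤ N(x+1)` for `x + h ≤ −1`. -/
theorem NSqC1_step_le (x : ℝ) (hx : x + ((((85 * n : ℕ) : ℝ) + 2) / 2) ≤ -1) :
    NSqC1 e n Y x ≤ NSqC1 e n Y (x + 1) := by
  have h := normSq_Rc_step_le_C1 he hn hY x (hcert _ (by push_cast at hx ⊢; linarith))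
  unfold NSqC1
  simpa using h

/-- **Every lattice point to the left of the centre is dominated by the centre values.** -/
theorem NSqC1_int_le_Mx_left (k : ℤ) (hk : (k : ℝ) + ((((85 * n : ℕ) : ℝ) + 2) / 2) ≤ 0) :
    NSqC1 e n Y k ≤ MxC1 e n Y := by
  set h : ℝ := ((((85 * n : ℕ) : ℝ) + 2) / 2) with hh
  set v : ℝ := (k : ℝ) + h with hv
  -- number of steps
  set m : ℕ := ⌊-v⌋₊ with hm
  have hv0 : 0 ≤ -v := by linarith
  have hfl : (m : ℝ) ≤ -v := Nat.floor_le hv0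
  have hfl' : -v < m + 1 := Nat.lt_floor_add_one (-v)
  have hmono := iter_mono (F := NSqC1 e n Y) (h := h) (fun x hx => NSqC1_step_le he hn hY hcert x hx) m k
    (by linarith)
  refine hmono.trans ?_
  -- the landing point `y = k + m` has `y + h ∈ (−1, 0]` and `2(y+h) ∈ ℤ`
  have hint : ∃ z : ℤ, 2 * ((k : ℝ) + m + h) = z := ⟨2 * k + 2 * m + (85 * n + 2 : ℕ), by
    rw [hh]; push_cast; ring⟩
  obtain ⟨z, hz⟩ := hint
  have hz1 : -2 < (z : ℝ) := by rw [← hz]; linarith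
  have hz2 : (z : ℝ) ≤ 0 := by rw [← hz]; linarith
  have hz1' : -2 < z := by exact_mod_cast hz1
  have hz2' : z ≤ 0 := by exact_mod_cast hz2
  have hcases : z = 0 ∨ z = -1 := by omega
  rcases hcases with h0 | h1
  · -- landing at the centre
    have : (k : ℝ) + m = -h := by
      have : 2 * ((k : ℝ) + m + h) = 0 := by rw [hz, h0]; simp
      linarith
    rw [this]
    exact le_max_left _ _
  · have : (k : ℝ) + m = -h - 1 / 2 := by
      have : 2 * ((k : ℝ) + m + h) = -1 := by rw [hz, h1]; simp
      linarith
    rw [this]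
    exact le_max_right _ _

omit hcert in
/-- Reflection on the lattice: `N(−(85n+2) − k) = N(k)` for `k ∈ ℤ`. -/
theorem NSqC1_symm_int (k : ℤ) : NSqC1 e n Y ((-((85 * n + 2 : ℕ) : ℤ) - k : ℤ) : ℝ) = NSqC1 e n Y k := by
  have h := NSqC1_symm he hn hY (x := (k : ℝ))
  have e1 : ((-((85 * n + 2 : ℕ) : ℤ) - k : ℤ) : ℝ) = -(((85 * n : ℕ) : ℝ) + 2) - (k : ℝ) := by
    push_cast; ring
  rw [e1]; exact h

/-- **`N(k) ≤ MxC1` for every integer `k`.** -/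
theorem NSqC1_int_le_Mx (k : ℤ) : NSqC1 e n Y k ≤ MxC1 e n Y := by
  by_cases hk : (k : ℝ) + ((((85 * n : ℕ) : ℝ) + 2) / 2) ≤ 0
  · exact NSqC1_int_le_Mx_left he hn hY hcert k hk
  · -- reflect
    rw [← NSqC1_symm_int he hn hY k]
    apply NSqC1_int_le_Mx_left he hn hY hcert
    push_cast at hk ⊢
    linarith

end Lattice

end Summit.KontsevichZagierPeriods.Zeta5Search.RayC1
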